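import Summits.BirchSwinnertonDyer.BirchSwinnertonDyer.Theses.SignedBaseChange
import Summits.BirchSwinnertonDyer.BirchSwinnertonDyer.Theorems.SignedBaseChangeAnticyclotomicEisensteinDivisibilityOfFiniteExponentTateTC
import Summits.BirchSwinnertonDyer.BirchSwinnertonDyer.Theorems.SignedBaseChangeAnticyclotomicEisensteinDivisibilityBdpLowerHalfAllAdditive
import Summits.BirchSwinnertonDyer.BirchSwinnertonDyer.Theorems.SignedBaseChangeAnticyclotomicEisensteinDivisibilityOrdinary
import Summits.BirchSwinnertonDyer.BirchSwinnertonDyer.Theorems.SignedBaseChangeAnticyclotomicEisensteinDivisibilityXAcTorsionOfLongoVigni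
import Summits.BirchSwinnertonDyer.BirchSwinnertonDyer.Theorems.SignedBaseChangeAnticyclotomicEisensteinDivisibilityMinusIsBDPSupersingularBCS
import Literature.NumberTheory.EllipticCurves.CastellaHsuKunduLeeLiu2025.HeegnerPointMainConjectureSupersingularBDP
import Literature.NumberTheory.IwasawaTheory.Greenberg2006.GlobalEulerPoincareCorankOfTateTC
import Literature.NumberTheory.GaloisCohomology.RestrictedRamificationPoitouTateThreeLeTotallyComplex
import Summits.BirchSwinnertonDyer.BirchSwinnertonDyer.Theorems.SignedBaseChangeAnticyclotomicEisensteinDivisibilityBdpLowerHalfSemistable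
import HarnessLib

/-! # Skeleton line `bdpline` (integral form) for the crux `AnticyclotomicEisensteinDivisibility`
**v37 (lead bsd-line-sbc-p1 gen 14, 2026-08-29) = v36 with HARARI THM. 17.13 (a) DISCHARGED and TATE'S GLOBAL EULER CHARACTERISTIC
WEAKENED TO TOTALLY COMPLEX FIELDS.** EVENT: the cell `bsd-eis` (line `x1-p1`, lane «PT3-TC») landed
`GaloisCohomology.forall_poitouTate_restricted_three_le_of_isTotallyComplex` (p681302): Harari Thm. 17.13 (a) PROVED at every totally
complex number field (NSW (8.3.18) `cd_p G_{K,S} ≤ 2` by the class-formation road). Up to v36 conjunct 5 of `stub_namedFactsSS` read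
`Gr16 4.1.1 ∧ (∀ K, Tate EPC K) ∧ (∀ K, PT 17.13 (a) K)` at EVERY number field, consumed through Greenberg 2006 Prop. 4.1 (`prop41SS`) and —
via NSW (8.3.20) `nswSS` — Prop. 3.2 in every degree (`stub_greenberg2016FactsSS`), although the Greenberg road READS them only at the
imaginary quadratic `K` and Prop. 3.2 only in degrees `≤ 2`. KERNEL WORK (this gen): the `OfTateTC` re-plumb of the road
(`SignedBaseChangeAcDivGreenbergRoadOfTateTC`: twins of p625450 / p627029 / p628494 with Prop. 3.2 by name ↦ Tate at totally complex fields by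
name, read through `Greenberg2006.prop32_global_le_two_of_tate_tc` / `prop32_local_holds`) and `SignedBaseChangeAcDivOfFiniteExponentTateTC`
(`finiteExponentSS_of_prop411_of_tateTC`: the finite exponent of `X_Gr₂[T₁]` from Gr16 4.1.1 + Tate (TC) alone — Gr16 4.2.2, Gr06 4.2 / §5 A
tree theorems, Gr06 4.1 ⟸ Tate (TC) + the proved 17.13 (a) (TC) by `prop41_of_tate_of_poitouTate_three_le_of_isTotallyComplex`; and the BCS
census re-typed with the finite exponent as a HYPOTHESIS, `anticyclotomicEisensteinDivisibility_of_xAcTorsionSS_of_finiteExponent`, so the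
Greenberg road never again touches the composition). RESHAPE: conjunct 5 := `Gr16 4.1.1 ∧ (∀ K [IsTotallyComplex K], Tate EPC K)` — the
Poitou–Tate conjunct is GONE and Tate is carried only at totally complex fields (the shape the `bsd-eis` lane «TATE-EPC-TC» is proving:
its landing drops the conjunct by a one-token edit); `nswSS` and `stub_greenberg2016FactsSS` leave the file (nothing consumes Prop. 3.2 /
NSW by name any more); new derived `finiteExponentSS`; `prop41SS` re-derived from Tate (TC). Named facts 9 → 8 (YZ26 ×3 as one, LV19 1.4,
CW24 proof-of-6.8 inputs, Gr16 4.1.1 + Tate EPC (TC), BCS25 ×2, CHKLL25, BLV26∘CW24 flag K1). Stub LIST (4, names and the texts of (a2),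
S1-rat-mult, S1∣ byte-identical to v36): stub_namedFactsSS · stub_xAcTorsionSS_classDvd · stub_bdpLowerHalfRatSS_mult · stub_bdpLowerHalfRatSS_classDvd.
**v36 (lead bsd-line-sbc-p1 gen 13, 2026-08-29) = v35 with the RESEARCH CELL RESTATED IN THE CRUX'S NATIVE (BDP) CURRENCY and TWO
refereed conjuncts DROPPED.** The research stub of v33–v35, `stub_signedEisensteinSS_mult` (Form T: the Eisenstein `⊆` of Castella–Wan's
signed Heegner-point statement 4.8 (3) up to `p^k`, over an auxiliary class `z` bound by the six-field hypothesis structure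
`AcSigned.TransferInputs`), fed the last branch of the derived S1 through the transfer glue p649794 ∘ p634573, which consumes Castella–Wan
2024 Lemma 6.7 (conjunct 4) and "`Sel_± = Sel^{±,rel}`" (conjunct 5). v36 states that branch's goal ITSELF as the research stub
`stub_bdpLowerHalfRatSS_mult` = the derived S1's text (`∃ k, (p^k)·ch_Λ(X_ac)·𝒪_{ℂ_p}⟦T⟧ ⊆ (J₀ L)` for every Castella-2018 BDP frame and
all compatible `J, J₀`, granted `X_ac` `Λ`-torsion) with the three cell binders `¬ p ∣ h_K`, `¬ (Squarefree N ∧ E[p] ramified at every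
q ∣ N)`, `¬ (every prime of N to the second power)` — and the branch becomes a direct call. KERNEL JUSTIFICATION (this gen): Form T ⟹
the new text is p649794; the new text's Castella–Wan form ⟹ Form T is `SignedBaseChangeAcDivEisensteinTransferConverse[XAc]` (p679702,
p680159: Castella–Wan Thm 6.8 for the `⊆` divisibilities as a kernel `iff` on `AcSelmer.XAc`, forward half p634573), and the class binder
of Form T is rigid (`SignedBaseChangeAcDivTransferClassRigidity`, p678685) — the two research statements are ONE debt, so the skeleton
books it where it needs the fewest named facts. RESHAPE: `stub_namedFactsSS` loses conjuncts 4–5 (11 → 9: refereed ×8 — YZ26 ×3 as one,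
LV19 1.4, CW24 proof-of-6.8 inputs (still needed with LV19 for (a1) `X_ac` torsion at `p ∤ h_K`), Gr16 4.1.1 + {Tate EPC, PT 17.13 (a)},
BCS25 ×2, CHKLL25 — plus BLV26∘CW24 with flag K1; ZERO preprint); projections renumbered; the derived coprime form
`AnticyclotomicEisensteinDivisibility_coprime_of` is DROPPED from the file (its glue p671565 and the CoprimeSS kit p674687 /
`Lines/bdpline_coprime_ss.lean` v2 are typed against the v35 texts and stay on record; a v36-currency copy is a follow-up). Stub LIST (4):
stub_namedFactsSS · stub_xAcTorsionSS_classDvd · stub_bdpLowerHalfRatSS_mult · stub_bdpLowerHalfRatSS_classDvd (texts of (a2) and S1∣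
byte-identical to v35).
**v35 (lead bsd-line-sbc-p1 gen 10) = v34 + the coprime-class-number severance RESTORED against the v34 text**: the derived
`AnticyclotomicEisensteinDivisibility_coprime_of` (the crux with the binder `¬ p ∣ h_K` from {`stub_namedFactsSS`, `stub_signedEisensteinSS_mult`}
alone) is back, fed by the pointwise copy `SignedBaseChangeAcDivCoprimeClassNumberMultBCS.anticyclotomicEisensteinDivisibility_coprime_of_stubs_mult_bcs`
of p658739 (conjunct 8 := the BCS fact). Nothing else changed w.r.t. v34.
**v34 (lead bsd-line-sbc-p1 gen 10, 2026-08-28) = v33 with conjunct 8 of `stub_namedFactsSS` RE-SOURCED from the PREPRINT to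
REFEREED print.** The comparison "`(G⁻) = (L_p^BDP)` as ideals of `𝒪_{ℂ_p}⟦T⟧`" was, up to v33, the claim-tagged binder
`BurungaleSkinnerTianWan2024.prop627_span_minus_eq_span_bdp_supersingular_PRE` (BSTW arXiv:2409.01350 Prop. 6.27 (i), unrefereed). The
line's composition consumes it only at `a_p = 0` and only in the direction `(J₀ L) ≤ (G⁻)` (p633742, l.177), and the SAME comparison at
every prime of GOOD reduction `p > 2` is a sentence of REFEREED print already in the line's bibliography: Burungale–Castella–Skinner,
IMRN 2025, proof of Prop. 4.2.2 (p. 9 L10–13: "a direct comparison of the interpolation properties shows that the projection of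
`L_p^Gr(g/K)` to `Λ_K^{−,ur}` generates the same ideal as `L_p^BDP(g/K)` (see [CGS23, Prop. 1.4.5])"; object = Conj. 4.1.2's `L_p^Gr`
at good `p`) — the very proof whose CONCLUSION `μ(G⁻) = 0` the line books as refereed twice over (antecedent conjunct 1
`prop422_greenbergAnyRoot_hasUnitContent_minus`, conjunct 10 `prop422_exists_isBDPLFunction_mu_eq_zero`). This seat TYPED that sentence
as the named fact `BurungaleCastellaSkinner2025.proofProp422_span_minus_eq_span_bdp_goodReduction` (p669772, reviewed: binders = the
sibling prop422 fact VERBATIM incl. (irr_K), (disc); BDP-frame / conclusion block = Yan–Zhu `prop314_…_guarded` VERBATIM; reading flag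
`BCS-422-comparison-via-CGS`: BCS prove it by citing CGS23 Prop. 1.4.5, printed under CGS's ordinary standing hypothesis by a
reduction-type-free comparison of interpolation formulas), landed the pointwise copies `SignedBaseChangeAcDivMinusIsBDPSSBCS.
stub_minusIsBDP_ss_of_bcs` (p670235; (irr_K) from `Surj`) and `SignedBaseChangeAcDivOfFactsRefereedBCS.anticyclotomicEisensteinDivisibility_
of_refereedFacts_bcs` (the census p633742 with the binder exchanged), and RESHAPES: in `stub_namedFactsSS` conjunct 8 becomes the BCS
fact (position unchanged); `stub_minusIsBDP` and `AnticyclotomicEisensteinDivisibility_of` are re-fed through the copies. DROPPED from the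
file (they rebuilt conjunctions containing the preprint binder, for consumers typed against older texts; orphans): `namedFactsSS_v30`,
`namedFactsSS_v31`, `AnticyclotomicEisensteinDivisibility_coprime_of` (the coprime severance stays on record: p642307 / p650754 / p658739
against the v27–v33 texts; a pointwise copy against the v34 text is a follow-up). GRADES after v34: named facts ×11 = refereed ×9
(YZ26 ×3 counted as one conjunct, LV19, CW24 ×3, Gr16 4.1.1 + 2 textbook roots, BCS25 ×2, CHKLL25) + ONE published-with-unsourced-step
(BLV26 ∘ CW24, flag K1) + ZERO preprint. Stub LIST unchanged (4); stub TEXT of `stub_namedFactsSS` changed (one conjunct); the other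
three stubs byte-identical. Also this gen (trust base of conjunct 3, unchanged in the text): p667920 conjunct 3 ⟸ conjunct 4 +
{(6.12), (6.13), Thm. 6.2 ideal form, `L_p^BDP ≠ 0`}; engines p668370 / p669320 / p668879 (limit exactness, Pontryagin limits).
**v33 (lead bsd-line-sbc-p1 gen 7, 2026-08-28) = v32 with the RESEARCH STUB NARROWED A SECOND TIME: `stub_signedEisensteinSS_live` ⟶
`stub_signedEisensteinSS_mult`** = the same text with ONE extra binder right after the semistable-ramified binder, namely
`¬ (∀ ℓ : ℕ, ℓ.Prime → ℓ ∣ N → ℓ ^ 2 ∣ N) →` (some prime divides `N` EXACTLY ONCE, i.e. `W` has a multiplicative prime). The only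
call site of the research stub — the last branch of S1's four-way split — already holds this hypothesis (`hsq`: the all-additive cell
goes to the Bertolini–Longo–Venerucci branch), so the composition is unchanged in content; the registered research statement now READS
exactly its live locus: Form T (the rational Eisenstein inclusion of Castella–Wan's signed Heegner-point main conjecture 4.8 (3), sign `+`,
up to `p^k`) on {`p ∤ h_K`} × {`W` with a prime `q ∥ N`, off the cell `N` square-free ∧ `E[p]` ramified at every `q ∣ N`} = cells β/γ of
`Ideas/primkoly.md` §B7 — and the level-raising prime `q ∥ N` that every printed Kolyvagin-primitivity argument for the Eisenstein
direction consumes (W. Zhang 2014, Sweeting 2020, Burungale–Castella–Kim 2021, C.-H. Kim) is a HYPOTHESIS of the promoted statement, not a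
gap in it. Glue (lead gen 7): `SignedBaseChangeAcDivS1OfSignedEisensteinMult.bdpLowerHalfRatSS_mult_of_signedEisensteinMult` (helper C″ =
w7's C′ p649794 with `hmult` threaded) feeds the Form-T branch of `stub_bdpLowerHalfRatSS` with the branch's own `hsq`;
`SignedBaseChangeAcDivCoprimeClassNumberMult.anticyclotomicEisensteinDivisibility_coprime_of_stubs_mult` (= w7's p650754 re-run against the
v32 named-facts text VERBATIM and the twice-narrowed stub) gives the derived coprime form of the crux directly from `stub_namedFactsSS`
(no adapter). presearch (lead gen 7, corpus fts + vec, galaxy all, arXiv/zbMATH/Crossref 2023+): no print on cells β/γ — CHKLL 2025 hyp.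
(ii) «`E[p]` ramified at every `ℓ ∣ N⁺`» is verbatim [paper:arxiv-2308.10474 p0029], BBL23 / CW24 Thm 5.3 / CLW22 / Fouquet–Wan need
square-free `N` or a non-split prime, BLV26 excludes multiplicative `q ∣ N⁺`, arXiv:2505.08710 gives the Howard direction only. Stub LIST
(4): stub_namedFactsSS · stub_xAcTorsionSS_classDvd · stub_signedEisensteinSS_mult · stub_bdpLowerHalfRatSS_classDvd (texts of the other
three byte-identical to v32).
**v32 (lead bsd-line-sbc-p1 gen 6, ADOPTING the candidate of width seat bsd-line-sbc-p1-w2 gen 9, 2026-08-28) = v31 with the textbook fact NSW (8.3.20) = Harari Cor. 17.17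
(`GaloisCohomology.finite_restrictedCohomology`, for every number field) DERIVED, NOT ASSUMED.** As TYPED, Tate's global Euler–Poincaré
characteristic `tateGlobalEulerPoincareCharacteristic K` (Milne ADT I Thm. 5.1, p648051) is a `Nat.card` identity with finiteness NOT folded in,
`#H⁰(G_S,M)·#H²(G_S,M)·∏_w #M^{mult w} = #H¹(G_S,M)·∏_w #H⁰(K_w,M)`, whose right-hand side is non-zero unconditionally (`H¹(G_S,M)` finite by
Hermite + Serre III §4.1 Prop. 8; `Γ_{K_w}` finite), so `H²(G_S, M)` is finite; degrees `0, 1` are unconditional tree theorems and `r ≥ 3`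
follows from Poitou–Tate 17.13 (a). Tree theorem (w2 gen 9): `GaloisCohomology.forall_finite_restrictedCohomology_of_tate_of_poitouTate_three_le :
(∀ K, tateGlobalEulerPoincareCharacteristic K) → (∀ K, poitouTate_restricted_three_le K) → ∀ K, finite_restrictedCohomology K`
(`Literature/NumberTheory/GaloisCohomology/RestrictedRamificationFiniteCohomologyOfTateEuler.lean`). RESHAPE: in `stub_namedFactsSS` the
Greenberg/textbook tuple (Gr16 4.1.1 ∧ ∀K Tate ∧ ∀K PT 17.13 (a) ∧ ∀K NSW) becomes (Gr16 4.1.1 ∧ ∀K Tate ∧ ∀K PT 17.13 (a)); the derived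
`nswSS` recovers NSW (8.3.20) for every number field; `prop41SS`, `stub_greenberg2016FactsSS`, `namedFactsSS_v30` are fed by it, and
`namedFactsSS_v31` rebuilds the v31 conjunction. TEXTBOOK ROOTS of the line after v32: {Tate global EPC (Milne I 5.1), Poitou–Tate 17.13 (a)}
(two, was three). Stub LIST unchanged (4); stub TEXT of `stub_namedFactsSS` changed (one conjunct fewer); the other three stubs byte-identical.
**v31 (lead bsd-line-sbc-p1 gen 6, 2026-08-28) = v30 with Greenberg 2006 Props. 4.1 AND 4.2 DISCHARGED.** Prop. 4.2 (the LOCAL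
Euler–Poincaré Λ-corank formula) is now an UNCONDITIONAL tree theorem — `Greenberg2006.prop42_localEulerPoincareCorank_holds` (width seat
bsd-line-sbc-p1-w2 gen 8: rank-mod-prime-element p648305, rank sequences p648653, smul sequences p649073, corank-mod-prime engine p651192 /
p651931, Tate base p651955, induction p653196, Summits one-liner p653816 fed by the tree's `localEulerPoincareCharacteristic_holds`) — and its
conjunct LEAVES `stub_namedFactsSS`. Prop. 4.1 (the GLOBAL formula, `K` totally imaginary) is a tree theorem MODULO TEXTBOOK FACTS —
`Greenberg2006.prop41_of_tateGlobalEulerPoincareCharacteristic : (∀ K, tateGlobalEulerPoincareCharacteristic K) → (∀ K,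
poitouTate_restricted_three_le K) → (∀ K, finite_restrictedCohomology K) → prop41` (width seat w8 gen 0: Tate fact p648051, readings p648723,
shell p650191, generic one-prime step p652218 on w2's engine, assemblies p651081 / p652909; w3 gen 6's vanishing p647853) — so in
`stub_namedFactsSS` the Prop-4.1 conjunct is REPLACED by Tate's GLOBAL Euler–Poincaré characteristic (Milne ADT I Thm. 5.1) and Harari's
Thm. 17.13 (a) (`poitouTate_restricted_three_le`); NSW (8.3.20) was already there. GREENBERG BLOCK after v31: of the original six printed
facts (Gr16 4.1.1 / 4.2.2, Gr06 3.2 / 4.1 / 4.2 / §5 A) only Gr16 4.1.1 remains a named fact (a kernel reduction to [Gr4] Thm 1 / Props 5.2,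
6.3 / [Gr10] exists — w5/w6 gen 0, p651244 … — but is deliberately NOT folded: it would trade one refereed fact for four); the others are
THEOREMS resting on the textbook facts {Tate global EPC, Poitou–Tate 17.13 (a), NSW (8.3.20)}. `namedFactsSS_v30` rebuilds the v29/v30
conjunction for the consumers typed against it (w7's p650754). Stub LIST unchanged (4); stub TEXT of `stub_namedFactsSS` changed.
**v30 (lead bsd-line-sbc-p1 gen 6, 2026-08-28) = v29 with the RESEARCH STUB NARROWED: `stub_signedEisensteinSS_coprime` ⟶
`stub_signedEisensteinSS_live`** = the same text with ONE extra binder after `¬ p ∣ NumberField.classNumber K →`, namely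
`¬ (Squarefree N ∧ ∀ q ∣ N, E[p] ramified at q) →` — Form T is now demanded ONLY OFF the semistable-ramified cell (closed in print
by CHKLL 2025, v29). The last branch of S1's four-way split consumes it through the width seat bsd-line-sbc-p1-w7's pointwise copy of
p636665, `SignedBaseChangeAcDivS1OfSignedEisensteinLive.bdpLowerHalfRatSS_live_of_signedEisensteinLive` (p649794), and the derived
coprime form of the crux through w7's `SignedBaseChangeAcDivCoprimeClassNumberLive.anticyclotomicEisensteinDivisibility_coprime_of_stubs_live`
(copy of p642307 fed by the v29 fact list and the narrowed stub). RESEARCH CONTENT of the registered line after v30: Form T on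
{`p ∤ h_K`} × {`W` non-semistable with some `q ∥ N`, or some `q ∥ N` at which `E[p]` is unramified (`p ∣ ord_q(Δ_W)`)}; K1 (BLV
Step 4 unsourced) on the all-additive cell; the two `p ∣ h_K` stubs (severable by the planner's restate). Stub LIST (4):
stub_namedFactsSS · stub_xAcTorsionSS_classDvd · stub_signedEisensteinSS_live · stub_bdpLowerHalfRatSS_classDvd.
**v29 (lead bsd-line-sbc-p1 gen 6, 2026-08-28) = v28 + the SEMISTABLE SLICE of S1 CLOSED IN PRINT + Greenberg 2016 Prop. 4.2.2
DISCHARGED** (`Greenberg2016.prop422_localCohomology_isAlmostDivisible_holds`, width seat bsd-line-sbc-p1-w6 gen 0, p648671 + p649329,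
with w5 gen 0's p648086/p648698 as parallel infrastructure: the conjunct LEAVES `stub_namedFactsSS`; the Greenberg tuple is now
(Gr16 4.1.1 ∧ Gr06 4.1 ∧ Gr06 4.2 ∧ NSW (8.3.20)); `stub_greenberg2016FactsSS` and `namedFactsSS_v27` recover 4.2.2 from the theorem).** On the sub-cell
{`N` square-free ∧ `E[p]` ramified at every `q ∣ N`} × {`p ∤ h_K`} the rational Eisenstein half S1 follows from the REFEREED named
fact `CastellaHsuKunduLeeLiu2025.thm71_cor72_exists_isCWBDPLFunction_charIdeal_map_le_rat` (Castella–Hsu–Kundu–Lee–Liu, Trans. AMS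
Ser. B 12 (2025) Thm. 7.1 / Cor. 7.2: the ± Heegner point main conjecture and Castella–Wan's statement 5.2 at `N⁻ = 1`; typed p648625,
this seat) through the width seat bsd-line-sbc-p1-w7's glue `SignedBaseChangeAcDivBdpLowerHalfSemistable.bdpLowerHalfRatSS_semistable_of_CHKLL`
(a copy of the Bertolini–Longo–Venerucci glue p636697 with bullet 5 replaced by (i) square-free + (ii) ramified). RESHAPE:
`stub_namedFactsSS` gains a TWELFTH conjunct (the CHKLL fact, appended LAST: the BCS25 conjunct's projection becomes `….2.1`); the
derived S1 `stub_bdpLowerHalfRatSS` is now a FOUR-way split — `p ∣ h_K` ⟶ S1∣ (research); all-additive ⟶ BLV; square-free ∧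
ramified-at-every-`q` ⟶ CHKLL (PRINT); otherwise ⟶ Form T. The registered TEXT of `stub_signedEisensteinSS_coprime` is UNCHANGED
(it is invoked on fewer inputs: its live locus is {`p ∤ h_K`} × {`W` non-semistable with some `q ∥ N`, or some `q ∥ N` with
`p ∣ ord_q(Δ_W)`}); narrowing its text by the complementary binder is a follow-up reshape (needs pointwise copies of p636665/p642307).
Stub LIST unchanged (4).
**v28 (lead bsd-line-sbc-p1 gen 6, 2026-08-28) = v27 with Greenberg 2006 Prop. 3.2 DISCHARGED to the textbook fact NSW (8.3.20).**
The conjunct `Greenberg2006.prop32_cohomology_isCofinitelyGenerated` of `stub_namedFactsSS` (cofinite generation of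
`Hⁱ(K_Σ/K, 𝒟)` and `Hⁱ(K_v, 𝒟)`) is now a tree THEOREM modulo ONE textbook named fact: the width seats of this line
landed print's proof — long exact sequences and the `λ`-dévissage for Mathlib's continuous cohomology (bsd-line-sbc-p1-w4
gen 6: p643181, p643470, p643961, p644584, p644990 `ContinuousRep.module_finite_characterModule_continuousCohomology`),
the criterion / Nakayama-for-duals / reduction (w3 gen 5: p641752, p642876, p643636, p644029), the archimedean and
degree-0 clauses (w2 gen 7: p644393, p644802) and `H¹(K_S/K, finite)` finite (w2 gen 7 p645881; w3 gen 6 p645896),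
the local finiteness hypothesis (F)(i) at every finite place in every degree UNCONDITIONALLY (w4 gen 6,
`CohomologyCofinitelyGeneratedLocal`: `H⁰ ⊆ A`, Serre II §5.2 for `H¹`, Tate `(2,0)`-duality for `H²`, `cd_p ≤ 2` for
`n ≥ 3`), the global hypothesis (F)(ii) from the named fact `GaloisCohomology.finite_restrictedCohomology` = Harari
Cor. 17.17 = NSW (8.3.20) (w3 gen 6 p645712 + `CohomologyCofiniteGenerationGlobalHyp`), and the assembly at the fact's
binders (this seat: p645422 `prop32_of_hypF`, `CohomologyCofiniteGenerationHolds`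
`prop32_cohomology_isCofinitelyGenerated_of_finite_restrictedCohomology`). RESHAPE: in `stub_namedFactsSS` the Greenberg
2006 Prop. 3.2 conjunct is REPLACED by `∀ K, GaloisCohomology.finite_restrictedCohomology K` (textbook grade); the
derived `stub_greenberg2016FactsSS` recovers Prop. 3.2 through the new theorem; `namedFactsSS_v27` rebuilds the
v27 conjunction for the consumers typed against it (p642307). Stub LIST unchanged (4); stub TEXT of `stub_namedFactsSS`
changed (one conjunct); the other three stubs byte-identical.
**v27 (lead bsd-line-sbc-p1 gen 5, 2026-08-28) = v26 + the COPRIME-CLASS-NUMBER SEVERANCE, documented in-file; stub TEXTS and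
the stub LIST unchanged (4).** The two `p ∣ h_K` stubs ((a2) `stub_xAcTorsionSS_classDvd`, S1∣ `stub_bdpLowerHalfRatSS_classDvd`)
are consumed ONLY on the sub-cell `p ∣ h_K`; the derived theorem `AnticyclotomicEisensteinDivisibility_coprime_of` below (=
`SignedBaseChangeAcDivCoprimeClassNumber.anticyclotomicEisensteinDivisibility_coprime_of_stubs`, p642307) gives the crux's text WITH
ONE EXTRA BINDER `¬ p ∣ NumberField.classNumber K` from `stub_namedFactsSS` and `stub_signedEisensteinSS_coprime` ALONE. The parent
K1″ quantifies `K` existentially, and its `∃`-half can be chosen with `p ∤ h_K` GRANTED the refereed fact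
`QuadraticFields.BRR2022_thm_1` (even-rung Heegner-field supply; `SignedBaseChangeK1FrameDataCoprimeClassNumber.
stub_frameDataBCSsplit_canonical_coprimeClassNumber`, p642494), and K1″ then follows from the ES child and the COPRIME crux
(`SignedBaseChangeK1AcanchorCoprimeClassNumber.twistPairGreenbergProductDivisibilityCanonical_of_acanchorChildren_coprimeClassNumber`,
lead gen 5). So a planner's restate of this crux with the binder `¬ p ∣ h_K` makes the line a TWO-stub skeleton {named facts, Form T}
at the price of one refereed class-number fact on the route; until then the registered crux keeps the four stubs below.
**v26 = v25 with the BOOKING GRADE of the all-additive branch CORRECTED** (readers bsd-idea-14 g7 `Ideas/primkoly.md` v2.4–2.5 §B8 + critic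
idea-crit-15 V#19, verified by this seat on the published = arXiv-v2 TeX L3040–3047): the named fact's flag is now `BLV-step4-UNSOURCED-on-R4`
(docstring revision p638951 of p635489) — on the all-additive cell the published proof of BLV Thm A sources its supersingular Step 4 from
Fouquet–Wan Cor 1.9/1.10 (needs a Steinberg-type prime), BSTW Thms 1.5/1.6 and CÇSS Thm C (semistable): none applicable there. So the
all-additive branch of S1 is «closed modulo ONE named fact whose printed proof has an UNSOURCED step on exactly this cell» — booked as
resting on research-grade input K1 (rank-0 Eisenstein p-converse for the level-raised J_ξ), NOT as print; stub texts and kernel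
content unchanged. **v25 = v24 with Greenberg 2006 §5 A DISCHARGED** (width seat bsd-line-sbc-p1-w4 gen 2: `sec5A_localH2_subsingleton_of_LOC1_holds` p637207,
`greenberg2016FactsSS_of_five` p637745): `stub_namedFactsSS` lists Greenberg ×5, the old 6-conjunction is derived. **v24 (lead bsd-line-sbc-p1 gen 4,
2026-08-28): S1 RESHAPED and every PRINT stub DERIVED from ONE named-facts stub.**
(i) The research stub S1 `stub_bdpLowerHalfRatSS` (rational Eisenstein half of the BDP anticyclotomic main conjecture, good
supersingular `p ≥ 5`, `Surj`, Heegner `K`, ANY conductor, every frame) is now DERIVED by a three-way split: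
`p ∣ h_K` ⟶ `stub_bdpLowerHalfRatSS_classDvd` (RESEARCH residual: no anticyclotomic signed theory in print at `p ∣ h_K`);
`p ∤ h_K` and every prime of `N` divides it squared (every bad prime ADDITIVE) ⟶ closed modulo the named fact
`BertoliniLongoVenerucci2026.thmA_castellaWan_thm68_exists_isCWBDPLFunction_charIdeal_map_le_rat` (BLV Math. Ann. 2026
Thm. A through Castella–Wan 2024 Thm. 6.8; reliability flag `BLV-step4-UNSOURCED-on-R4` since v26 — booked as research-grade input K1,
not print) by this seat's
`SignedBaseChangeAcDivBdpLowerHalfAllAdditive.bdpLowerHalfRatSS_allAdditive_of_BLV` (p636697 glue + p637170 kernel discharge of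
BLV's Hyp. 1.1 bullet 5 at `p ≥ 5` by Kodaira–Néron, with the width seat's frame concordance p634869);
`p ∤ h_K` otherwise ⟶ `stub_signedEisensteinSS_coprime` (RESEARCH, the Eisenstein ⊆ of Castella–Wan's Heegner-point statement
4.8 (3) up to `p^k`, in TransferInputs/IsCWBDPLFunction currency, sign `+`, `ι`-form — width seat bsd-line-sbc-p1-w2 gen 5's
text VERBATIM) through the width seat's `SignedBaseChangeAcDivS1OfSignedEisenstein.bdpLowerHalfRatSS_coprime_of_signedEisenstein`
(p636665: Eisenstein transfer p634573 + frame concordance p634869 + w3's injectivity p636022 + four refereed typed facts).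
(ii) The print stubs of v23 are DERIVED from the single stub `stub_namedFactsSS` (a conjunction of TYPED named facts, graded
in its docstring): `stub_ordSlice` by `SignedBaseChangeAcDivOrdinary.acDivChild_of_goodOrd` (p550979, YZ26 ×3),
`stub_xAcTorsionSS_coprime` by `SignedBaseChangeAcDivXAcTorsionOfLongoVigni.xAcTorsionSS_of_longoVigni_castellaWan` (p632902,
LV19 + CW24), `stub_greenberg2016FactsSS` (projection), `stub_minusIsBDP` by `SignedBaseChangeAcDivMinusIsBDPSS.stub_minusIsBDP_ss_of_facts`
(p630219, BSTW24 PRE + BCS25). (iii) The composition is gen 3's kernel census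
`SignedBaseChangeAcDivOfFactsRefereed.anticyclotomicEisensteinDivisibility_of_refereedFacts` (p633742), fed by the facts, by
`stub_xAcTorsionSS_classDvd` and by the derived S1. OPEN STUBS (4): `stub_namedFactsSS` [typed named facts —
refereed YZ26 ×3, LV19, CW24 ×3, Greenberg ×5 (v25; ×6 in v24), BCS25; published-with-UNSOURCED-step BLV26∘CW24 (flag
`BLV-step4-UNSOURCED-on-R4`, research-grade booking); preprint BSTW24 Prop. 6.27 (i)] ·
`stub_xAcTorsionSS_classDvd` [(a2), `p ∣ h_K`: OPEN-preprint claim CCSS18 Thm. 5.7 only] · `stub_signedEisensteinSS_coprime`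
[RESEARCH; needed only OFF the all-additive cell] · `stub_bdpLowerHalfRatSS_classDvd` [RESEARCH; `p ∣ h_K`]. Research content of
the crux after v24/v26: the Eisenstein half of the signed Heegner-point main conjecture at `p ∤ h_K` for curves WITH a
multiplicative prime (cells β/γ of `Ideas/primkoly.md` v2.3 §B7), everything at `p ∣ h_K`, AND — inside the BLV conjunct of
`stub_namedFactsSS` — the unsourced Step 4 (rank-0 Eisenstein p-converse for level-raised forms, K1) on the all-additive cell.

(v23 header follows.)
**v23 = v22 with the class-number binder placed after `κ₂.IsAnticyclotomic`** (the position of the width seat's landed theorem p632902, so (a1) is that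
theorem's type minus its two fact hypotheses, byte-comparable). **v22 (lead bsd-line-sbc-p1 gen 3, 2026-08-28): RESHAPE of (a) `stub_xAcTorsionSS` by the class number** — (a1) `stub_xAcTorsionSS_coprime` (extra binder
`¬ p ∣ h_K`: the REFEREED road Longo–Vigni 2019 Thm. 1.4 + Castella–Wan 2024 Thm. 6.8 through Kobayashi's signed Selmer carriers, width seat
bsd-line-sbc-p1-w4 gen 0, assembly in flight) and (a2) `stub_xAcTorsionSS_classDvd` (`p ∣ h_K`: only the OPEN preprint claim CCSS18 Thm. 5.7, p618123);
(a) itself is derived by cases, the composition is unchanged. Purpose: the registry separates the refereed sub-case from the preprint sub-case, and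
the width seat's assembly lands WITH stub credit. Open stubs (6): stub_ordSlice · stub_xAcTorsionSS_coprime · stub_xAcTorsionSS_classDvd ·
stub_greenberg2016FactsSS · stub_bdpLowerHalfRatSS · stub_minusIsBDP.

**v9–v21 (lead bsd-line-sbc-p1 gens 2–3, 2026-08-28)**: S1 rational form and every-frame form, S2b finite exponent, torsion lane
(torsplice → (a)+(S)+(V)+(b₁)), Greenberg-2016 road for the finite exponent with the kernel bricks (R1a)/(R1b), (a) split by the class
number — full texts in the earlier commits of this file (`Cruxes/…/Lines/bdpline.lean` history) and in HOME/bsd-line-sbc-p1/gen2–gen3 notes.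

(v8 header follows.)
(stmt-BirchSwinnertonDyer-20727 — rev 20 render-compat restate of stmt-…-20576, antecedent `SignedTwoVariableInputs` written BY VALUE, δ-equal;
child of K1″ `TwistPairGreenbergProductDivisibilityCanonical` along `acanchor`, route SignedBaseChange rev 22) — lead sbc-p1 g5 (design, 2026-08-27 16:0xZ),
registered on 20727 by lead sbc-p1 g6 (2026-08-27 17:1xZ); RESHAPED v2 by sbc-p1 g6; RESHAPED v3/v4 by sbc-p1 g7 (2026-08-27; v4: S2a = f.g. + Λ₂-torsion only, S2c proved): the S2 ALGEBRA (specialisation `T₁ ↦ 0` of characteristic ideals, local/global Herbrand formula) is PROVED (Theorems/…Specialization{Length,Cyclic,Herbrand,S2}.lean, p562525 p563295 p564000 + S2 file), so `stub_xGrIsTorsionSS` (S0) and `stub_specializationSS` (S2) are REPLACED by their three arithmetic inputs `stub_fgQuotTorsionSS` (f.g. + `X_Gr₂/T₁` `Λ₁`-torsion), `stub_noXTorsionSS` (`X_Gr₂[T₁] = 0`), `stub_controlSurjSS` (control surjection), from which S0 and S2 are DERIVED in the composition; the `Λ₁`-structure on `X_Gr₂/T₁X_Gr₂` is pinned to the constants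 `PowerSeries.C` (`letI := Module.compHom _ PowerSeries.C`; NB Mathlib's default `Algebra Λ₁ Λ₂` is `T ↦ T₁`). Earlier (v2): the ORDINARY slice is
refereed print (landed p550979 `SignedBaseChangeAcDivOrdinary.acDivChild_of_goodOrd`, modulo 3 PUB facts: the crux = `Ideal.map constantCoeff`
of the two-variable Eisenstein inclusion, YZ26 Thm 4.2(2)+4.7+3.3), so it becomes ONE stub `stub_ordSlice`, and the BDP-currency stubs S0/S1/S2 are
RESTRICTED to the supersingular slice `W.frobeniusTrace p = 0` (= the X7 pairs of the route); S3 stays reduction-type-free (closed modulo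
{prop314_guarded, prop627_PRE, prop422_exists}, p553754). Composition: dichotomy `p ∣ a_p ↔ a_p = 0` at `p ≥ 5`. The stubs keep the BY-NAME antecedent `SignedTwoVariableInputs →` (δ-equal to the
child's by-value conjunction; the composition instantiates them with the child's hypothesis by `intro`). Companion of the RATIONAL-child version (`Lines_bdpline_byname.lean`, for the rev 16-RAT
child `AnticyclotomicEisensteinDivisibilityRat` if the resplit lands). Concludes the crux BY NAME.

THE MOVE (v2): at a good ORDINARY prime the crux is print (`stub_ordSlice`); at a SUPERSINGULAR prime state the research content ONE variable at a
time in BDP currency (`X_Gr(E/K_∞⁻)` = `Castella2018.AcSelmer.XAc (W.baseChange K) p κ₂ vbar ∅ γ₂`, `IsBDPLFunction ι v κ₂ γ₂ f ΩK Ωp L`,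
structure maps `J : ℤ_p → 𝒪_{ℂ_p}`, `J₀ : R₀ → 𝒪_{ℂ_p}`):
* `stub_ordSlice` (PRINT): the crux with `GoodOrd W p` inserted — landed modulo {thm42, thm47_guarded, thm33} (p550979).
* v3/v4: `stub_fgTorsionSS` (v4; v3 had `stub_fgQuotTorsionSS`) + `stub_noPseudoNullSS` (v4; v3 had `stub_noXTorsionSS`) + `stub_controlSurjSS` (PROVED p567002) (S2a/b/c-ss, arithmetic inputs) replace S0/S2; S0 = torsion of
  `X_Gr₂` and S2 = `π(ch(X_Gr₂)^ur) ⊆ ch(X_Gr(E/K_∞⁻))·𝒪⟦T⟧` are DERIVED (`S2.exists_constantCoeff_ne_zero_of_isTorsion`, `S2.xGr₂_specialization_le_of_control`).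
* `stub_bdpLowerHalfExistsSS` (S1-ss, RESEARCH = G2″ in print currency): the INTEGRAL Eisenstein half of the one-variable BDP anticyclotomic main
  conjecture at a good supersingular `p ≥ 5`, `Surj`, classical Heegner, any `N`, for SOME BDP frame — BCS25 Thm 1.2.4 (b) shape with `GoodOrd` ↦ `a_p = 0`.
* `stub_minusIsBDP` (S3, SUPPORT, PRINT-grade): "`G⁻` IS a BDP `L`-function" — closed modulo {prop314_guarded, prop627_PRE, prop422_exists} (p553754).
Composition: the frames of S1 and S3 differ by a unit (`X11b.R1.exists_unit_mul_eq_of_isBDPLFunctionInt`); then pure inclusions — PROVED.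
-/

-- D-0017: single-problem summit, the namespace repeats the problem name by design.
set_option linter.dupNamespace false
set_option autoImplicit false

noncomputable section

open scoped Classical


namespace Summit.BirchSwinnertonDyer.BirchSwinnertonDyer.Cruxes.AnticyclotomicEisensteinDivisibility.Bdpline

open Summit.BirchSwinnertonDyer.BirchSwinnertonDyer.Theses.SignedBaseChange
open Literature.NumberTheory.EllipticCurves
open Summit.BirchSwinnertonDyer.BirchSwinnertonDyer.Theorems

/-! ## The stubs (v24: four — one PRINT (named facts), one PRE claim (a2), two RESEARCH) -/

/-- stub FACTS (PRINT; v24; **v37: conjunct 5 = Greenberg 2016 Prop. 4.1.1 ∧ Tate's global Euler characteristic AT TOTALLY COMPLEX FIELDS — Harari Thm. 17.13 (a) is PROVED there (p681302) and Greenberg 2006 Prop. 3.2 is read from Tate in degrees ≤ 2**; v36: NINE conjuncts — Castella–Wan 2024 Lemma 6.7 and "`Sel_± = Sel^{±,rel}`" (v24–v35 conjuncts 4–5, consumed only by the Form-T transfer glue) are GONE, the research cell being stated in BDP currency**): **the conjunction of every TYPED named fact the line consumes**, graded: REFEREED — Yan–Zhu 2026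
Thms. 4.2(2)/4.7/3.3 (ordinary slice), Longo–Vigni 2019 Thm. 1.4, Castella–Wan 2024 (proof-of-Thm.-6.8 inputs; Lemma 6.7; MS p. 30
`Sel^{ε,rel} ≤ Sel_ε`), Greenberg 2016 Prop. 4.1.1 (the only Greenberg fact left: §5 A is a tree THEOREM since p637207; Prop. 3.2 since v28 p646807 modulo NSW (8.3.20); Greenberg 2016 Prop. 4.2.2 since v29 p649329 and Greenberg 2006 Prop. 4.2 since v31 p653816, unconditionally; Prop. 4.1 since v31 p652909 modulo Tate global EPC + Poitou–Tate 17.13 (a) + NSW); TEXTBOOK — Tate global Euler–Poincaré characteristic (Milne ADT I Thm. 5.1, `tateGlobalEulerPoincareCharacteristic`), Poitou–Tate (Harari Thm. 17.13 (a), `poitouTate_restricted_three_le`),, Burungale–Castella–Skinner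
2025 Prop. 4.2.2, Castella–Hsu–Kundu–Lee–Liu 2025 Thm. 7.1 / Cor. 7.2 (v29: the semistable slice of S1); DERIVED SINCE v32 (no longer a conjunct) — Neukirch–Schmidt–Wingberg (8.3.20) = Harari Cor. 17.17 (`GaloisCohomology.finite_restrictedCohomology`, v28–v31 a conjunct replacing Greenberg 2006 Prop. 3.2; v32: `nswSS`, from the Tate and Poitou–Tate 17.13 (a) conjuncts by `GaloisCohomology.forall_finite_restrictedCohomology_of_tate_of_poitouTate_three_le`); PUBLISHED WITH AN UNSOURCED STEP — Bertolini–Longo–Venerucci 2026 Thm. A ∘ Castella–Wan 2024 Thm. 6.8 (flag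
`BLV-step4-UNSOURCED-on-R4`: on the all-additive cell none of the published Step-4 sources FW Cor 1.9/1.10, BSTW Thms 1.5/1.6, CÇSS
Thm C applies — BOOK as research-grade input K1, not as print); v34: NO preprint conjunct — the comparison `(G⁻) = (L_p^BDP)` is Burungale–Castella–Skinner 2025 (IMRN), proof of Prop. 4.2.2 (`proofProp422_span_minus_eq_span_bdp_goodReduction`, flag `BCS-422-comparison-via-CGS`; up to v33 this slot was Burungale–Skinner–Tian–Wan 2024 Prop. 6.27 (i) `_PRE`). Each conjunct is a
`def … : Prop` of `Literature/`; closing this stub = discharging them (`_holds`), which is literature work, not line work. -/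
theorem stub_namedFactsSS :
    (Literature.NumberTheory.EllipticCurves.YanZhu2026.thm42_XGr₂_isTorsion_charIdeal_le_greenbergAnyRoot ∧
      Literature.NumberTheory.EllipticCurves.YanZhu2026.thm47_ord_localised_iff_greenbergAnyRoot_localised_guarded ∧
      Literature.NumberTheory.EllipticCurves.YanZhu2026.thm33_exists_isHidaRankinLFunction) ∧
    (∀ (W : WeierstrassCurve ℚ) [W.IsGloballyMinimal] (K : Type) [Field K] [NumberField K] (p : ℕ) [Fact p.Prime]
      (κ : Literature.NumberTheory.EllipticCurves.ZpExtension K p) (𝔭 𝔭' : IsDedekindDomain.HeightOneSpectrum (NumberField.RingOfIntegers K)),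
      Literature.NumberTheory.EllipticCurves.AcSigned.longoVigni2019_thm14_signedSelmerDual_rank_one W K p κ 𝔭 𝔭') ∧
    (∀ (N : ℕ) [NeZero N] (W : WeierstrassCurve ℚ) [W.IsGloballyMinimal] (K : Type) [Field K] [NumberField K] (p : ℕ) [Fact p.Prime]
      (κ : Literature.NumberTheory.EllipticCurves.ZpExtension K p) (𝔭 𝔭' : IsDedekindDomain.HeightOneSpectrum (NumberField.RingOfIntegers K)),
      Literature.NumberTheory.EllipticCurves.AcSigned.castellaWan2024_proofThm68_transferInputs N W K p κ 𝔭 𝔭') ∧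
    Literature.NumberTheory.EllipticCurves.BertoliniLongoVenerucci2026.thmA_castellaWan_thm68_exists_isCWBDPLFunction_charIdeal_map_le_rat ∧
    (Literature.NumberTheory.IwasawaTheory.Greenberg2016.prop411_selmer_isAlmostDivisible ∧
      (∀ (K : Type) [Field K] [NumberField K] [NumberField.IsTotallyComplex K], Literature.NumberTheory.GaloisCohomology.tateGlobalEulerPoincareCharacteristic K)) ∧
    Literature.NumberTheory.EllipticCurves.BurungaleCastellaSkinner2025.proofProp422_span_minus_eq_span_bdp_goodReduction ∧
    Literature.NumberTheory.EllipticCurves.BurungaleCastellaSkinner2025.prop422_exists_isBDPLFunction_mu_eq_zero ∧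
    Literature.NumberTheory.EllipticCurves.CastellaHsuKunduLeeLiu2025.thm71_cor72_exists_isCWBDPLFunction_charIdeal_map_le_rat := by
  sorry

/-- stub (a2) (= v22/v23 `stub_xAcTorsionSS_classDvd`, text UNCHANGED): `X_ac` is `Λ`-torsion at `p ∣ h_K` — only the OPEN
preprint claim CCSS18 Thm. 5.7 (typed `…thm57_…_OPEN`, p618123 specialises it); no refereed source (the anticyclotomic signed
theory in print assumes `p ∤ h_K`). -/
theorem stub_xAcTorsionSS_classDvd :
    SignedTwoVariableInputs → Literature.NumberTheory.EllipticCurves.ModularForms.nonempty_modularParametrizationData → ∀ (W : WeierstrassCurve ℚ) [W.IsElliptic] [W.IsGloballyMinimal] (p : ℕ) [Fact p.Prime], 5 ≤ p → W.HasGoodReductionAtPrime p → W.frobeniusTrace p = 0 → Literature.NumberTheory.EllipticCurves.Rank1Residual.Surj W p → ∀ (K : Type) [Field K] [NumberField K] (ι : PadicAlgCl p ≃+* ℂ) (v vbar : IsDedekindDomain.HeightOneSpectrum (NumberField.RingOfIntegers K)) (κ₁ κ₂ : Literature.NumberTheory.EllipticCurves.ZpExtension K p) (γ₁ γ₂ :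 Field.absoluteGaloisGroup K) [Fact (Literature.NumberTheory.EllipticCurves.ZpExtension.IsTopGeneratorPair κ₁ κ₂ γ₁ γ₂)] [NeZero (NumberField.discr K).natAbs] (N : ℕ) [NeZero N] (f : CuspForm (CongruenceSubgroup.Gamma0 N) 2), Literature.NumberTheory.EllipticCurves.ModularForms.IsNewformOf W f → (N : ℤ) = W.conductorNorm ℤ → Literature.NumberTheory.EllipticCurves.IsImaginaryQuadratic K → ((Ideal.span {(p : ℤ)}).primesOver (NumberField.RingOfIntegers K)).ncard = 2 → ((p : ℕ) : NumberField.RingOfIntegers K) ∈ v.asIdeal → ((p : ℕ) : NumberField.RingOfIntegers K) ∈ vbar.asIdeal → vbar ≠ v → (∀ (w : NumberField.InfinitePlace K) (k : NumberField.RingOfIntegers K), k ∈ v.asIdeal ↔ ‖ι.symm (w.embedding (k : K))‖ < 1) → IsCoprime (N : ℤ) (NumberField.discr K) → (∀ ℓ : ℕ, ℓ.Prime → ℓ ∣ N → ((Ideal.span {(ℓ : ℤ)}).primesOver (NumberField.RingOfIntegers K)).ncard = 2) → Odd (NumberField.discr K) → NumberField.discr K ≠ -3 → κ₁.IsCyclotomic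 → κ₂.IsAnticyclotomic → p ∣ NumberField.classNumber K → (haveI : Fact (κ₂.IsTopGenerator γ₂) := ⟨Literature.NumberTheory.EllipticCurves.YanZhu2026.isTopGenerator_of_pair (κ₁ := κ₁) (γ₁ := γ₁)⟩; Module.IsTorsion (Literature.NumberTheory.EllipticCurves.IwasawaAlgebra p) (Literature.NumberTheory.EllipticCurves.Castella2018.AcSelmer.XAc (W.baseChange K) p κ₂ vbar ∅ γ₂)) := by
  sorry

/-- stub S1-rat-mult (RESEARCH; v36 — replaces v33's `stub_signedEisensteinSS_mult`): **the RATIONAL Eisenstein half of the BDP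
anticyclotomic main conjecture at a good supersingular `p ≥ 5` ON CELLS β/γ**, i.e. the derived S1 `stub_bdpLowerHalfRatSS` (below) with
the three binders `¬ p ∣ h_K →`, `¬ (Squarefree N ∧ ∀ q ∣ N, E[p] ramified at q) →`, `¬ (∀ ℓ prime, ℓ ∣ N → ℓ² ∣ N) →` inserted after
`IsImaginaryQuadratic K →` — the crux's NATIVE currency (`Castella2018.AcSelmer.XAc`, Castella-2018 BDP frames `IsBDPLFunction`, structure
maps `J`, `J₀`): for every BDP frame `(Ω_K ≠ 0, Ω_p′, L)` and all compatible `J : ℤ_p → 𝒪_{ℂ_p}`, `J₀ : R₀ → 𝒪_{ℂ_p}`,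
`∃ k, (p^k)·ch_Λ(X_ac)·𝒪_{ℂ_p}⟦T⟧ ⊆ (J₀ L)`, granted `X_ac` is `Λ`-torsion (which the line derives from Longo–Vigni 1.4 + Castella–Wan at
`p ∤ h_K`). WHY THE CURRENCY CHANGE (v24 → v33 stated this cell in signed-Heegner currency, Form T): Form T ⟹ this text is the KERNEL glue
`SignedBaseChangeAcDivS1OfSignedEisensteinMult.bdpLowerHalfRatSS_mult_of_signedEisensteinMult` (p649794 ∘ p634573, consuming CW24 Lemma 6.7
and CW24 "`Sel_± = Sel^{±,rel}`" = the former conjuncts 4–5 of `stub_namedFactsSS`), and conversely this text's Castella–Wan form implies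
Form T by the lead gen 13's `SignedBaseChangeAcDivEisensteinTransferConverseXAc.TransferInputs.formT_iff_XAc_charIdeal_map_le_span` (p680159,
modulo the same facts and the frame concordance p634869); so the two research statements are the same debt, and stating it HERE in BDP
currency removes two refereed conjuncts (CW24 Lemma 6.7, CW24 `Sel_± = Sel^{±,rel}`) and the auxiliary binders (`z`, `TransferInputs`, the
local generator data `h𝔭 γ𝔭 hγ𝔭`) from the crux's skeleton — a line for the PROMOTED item that argues through Kolyvagin systems re-imports
them as its own named facts via p634573. LIVE LOCUS = the statement's own hypotheses: {`p ∤ h_K`} × {`W` with some `q ∥ N`, off the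
square-free-and-ramified cell (CHKLL 2025, print) and off the all-additive cell (BLV 2026 branch)} = cells β/γ of `Ideas/primkoly.md` §B7;
no print (CW24 Thm 5.3 / CLW22 need a non-split prime; BLV26 excludes multiplicative primes in `N⁺`; CHKLL25 / BBL23 / Castella–Sano 26 need
square-free `N`; Fouquet–Wan needs a non-split Steinberg prime; lead g7/g11/g12/g13 presearch). -/
theorem stub_bdpLowerHalfRatSS_mult :
    SignedTwoVariableInputs → Literature.NumberTheory.EllipticCurves.ModularForms.nonempty_modularParametrizationData → ∀ (W : WeierstrassCurve ℚ) [W.IsElliptic] [W.IsGloballyMinimal] (p : ℕ) [Fact p.Prime], 5 ≤ p → W.HasGoodReductionAtPrime p → W.frobeniusTrace p = 0 → Literature.NumberTheory.EllipticCurves.Rank1Residual.Surj W p → ∀ (K : Type) [Field K] [NumberField K] (ι : PadicAlgCl p ≃+* ℂ) (v vbar : IsDedekindDomain.HeightOneSpectrum (NumberField.RingOfIntegers K)) (κ₁ κ₂ : Literature.NumberTheory.EllipticCurves.ZpExtension K p) (γ₁ γ₂ : Field.absoluteGaloisGroup K) [Fact (Literature.NumberTheory.EllipticCurves.ZpExtension.IsTopGeneratorPair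 κ₁ κ₂ γ₁ γ₂)] [NeZero (NumberField.discr K).natAbs] (N : ℕ) [NeZero N] (f : CuspForm (CongruenceSubgroup.Gamma0 N) 2), Literature.NumberTheory.EllipticCurves.ModularForms.IsNewformOf W f → (N : ℤ) = W.conductorNorm ℤ → Literature.NumberTheory.EllipticCurves.IsImaginaryQuadratic K → ¬ p ∣ NumberField.classNumber K → ¬ (Squarefree N ∧ ∀ q : ℕ, q.Prime → q ∣ N → ∃ v' : IsDedekindDomain.HeightOneSpectrum (NumberField.RingOfIntegers ℚ), ((q : ℕ) : NumberField.RingOfIntegers ℚ) ∈ v'.asIdeal ∧ ∃ 𝔓 ∈ v'.primesAbove, ∃ σ ∈ 𝔓.inertia (Field.absoluteGaloisGroup ℚ), ∃ P : W.geomTorsion (p : ℤ), σ • P ≠ P) → ¬ (∀ ℓ : ℕ, ℓ.Prime → ℓ ∣ N → ℓ ^ 2 ∣ N) → ((Ideal.span {(p : ℤ)}).primesOver (NumberField.RingOfIntegers K)).ncard = 2 → ((p : ℕ) : NumberField.RingOfIntegers K) ∈ v.asIdeal → ((p : ℕ) : NumberField.RingOfIntegers K) ∈ vbar.asIdeal →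 vbar ≠ v → (∀ (w : NumberField.InfinitePlace K) (k : NumberField.RingOfIntegers K), k ∈ v.asIdeal ↔ ‖ι.symm (w.embedding (k : K))‖ < 1) → IsCoprime (N : ℤ) (NumberField.discr K) → (∀ ℓ : ℕ, ℓ.Prime → ℓ ∣ N → ((Ideal.span {(ℓ : ℤ)}).primesOver (NumberField.RingOfIntegers K)).ncard = 2) → Odd (NumberField.discr K) → NumberField.discr K ≠ -3 → κ₁.IsCyclotomic → κ₂.IsAnticyclotomic → (haveI : Fact (κ₂.IsTopGenerator γ₂) := ⟨Literature.NumberTheory.EllipticCurves.YanZhu2026.isTopGenerator_of_pair (κ₁ := κ₁) (γ₁ := γ₁)⟩; Module.IsTorsion (Literature.NumberTheory.EllipticCurves.IwasawaAlgebra p) (Literature.NumberTheory.EllipticCurves.Castella2018.AcSelmer.XAc (W.baseChange K) p κ₂ vbar ∅ γ₂)) → ∀ (ΩK : ℂ) (Ωp' : (Literature.NumberTheory.EllipticCurves.unrIntegers p)ˣ) (L : Literature.NumberTheory.EllipticCurves.UnrSeries p), ΩK ≠ 0 → Literature.NumberTheory.EllipticCurves.IsBDPLFunction ι v κ₂ γ₂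 f ΩK ((Ωp' : Literature.NumberTheory.EllipticCurves.unrIntegers p) : PadicComplex p) L → ∀ J : ℤ_[p] →+* PadicComplexInt p, (∀ x : ℤ_[p], ((J x : PadicComplexInt p) : PadicComplex p) = ((x : ℚ_[p]) : PadicComplex p)) → ∀ (J₀ : Literature.NumberTheory.EllipticCurves.unrIntegers p →+* PadicComplexInt p), (∀ x : Literature.NumberTheory.EllipticCurves.unrIntegers p, ((J₀ x : PadicComplexInt p) : PadicComplex p) = (x : PadicComplex p)) → ∃ k : ℕ, ∀ y ∈ (haveI : Fact (κ₂.IsTopGenerator γ₂) := ⟨Literature.NumberTheory.EllipticCurves.YanZhu2026.isTopGenerator_of_pair (κ₁ := κ₁) (γ₁ := γ₁)⟩; Literature.NumberTheory.EllipticCurves.Castella2018.AcSelmer.XAc.charIdeal (W.baseChange K) p κ₂ vbar ∅ γ₂).map (PowerSeries.map J), PowerSeries.C (((p : ℕ) : PadicComplexInt p) ^ k) * y ∈ Ideal.span {PowerSeries.map J₀ L} := by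
  sorry

/-- stub S1∣ (RESEARCH; v24): **S1's registered text at `p ∣ h_K`** (binder `p ∣ NumberField.classNumber K` inserted after
`κ₂.IsAnticyclotomic →`). No print: every anticyclotomic signed/BDP source (Castella–Wan, Longo–Vigni, BLV, Castella 2018's
`δ = 0`) assumes `p ∤ h_K` (`AcSigned.Setting`); at `p ∣ h_K` the primes above `p` may split in the first layers of `K_∞⁻`. -/
theorem stub_bdpLowerHalfRatSS_classDvd :
    SignedTwoVariableInputs → Literature.NumberTheory.EllipticCurves.ModularForms.nonempty_modularParametrizationData → ∀ (W : WeierstrassCurve ℚ) [W.IsElliptic] [W.IsGloballyMinimal] (p : ℕ) [Fact p.Prime], 5 ≤ p → W.HasGoodReductionAtPrime p → W.frobeniusTrace p = 0 → Literature.NumberTheory.EllipticCurves.Rank1Residual.Surj W p → ∀ (K : Type) [Field K] [NumberField K] (ι : PadicAlgCl p ≃+* ℂ) (v vbar : IsDedekindDomain.HeightOneSpectrum (NumberField.RingOfIntegers K)) (κ₁ κ₂ : Literature.NumberTheory.EllipticCurves.ZpExtension K p) (γ₁ γ₂ : Field.absoluteGaloisGroup K) [Fact (Literature.NumberTheory.EllipticCurves.ZpExtension.IsTopGeneratorPair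 κ₁ κ₂ γ₁ γ₂)] [NeZero (NumberField.discr K).natAbs] (N : ℕ) [NeZero N] (f : CuspForm (CongruenceSubgroup.Gamma0 N) 2), Literature.NumberTheory.EllipticCurves.ModularForms.IsNewformOf W f → (N : ℤ) = W.conductorNorm ℤ → Literature.NumberTheory.EllipticCurves.IsImaginaryQuadratic K → ((Ideal.span {(p : ℤ)}).primesOver (NumberField.RingOfIntegers K)).ncard = 2 → ((p : ℕ) : NumberField.RingOfIntegers K) ∈ v.asIdeal → ((p : ℕ) : NumberField.RingOfIntegers K) ∈ vbar.asIdeal → vbar ≠ v → (∀ (w : NumberField.InfinitePlace K) (k : NumberField.RingOfIntegers K), k ∈ v.asIdeal ↔ ‖ι.symm (w.embedding (k : K))‖ < 1) → IsCoprime (N : ℤ) (NumberField.discr K) → (∀ ℓ : ℕ, ℓ.Prime → ℓ ∣ N → ((Ideal.span {(ℓ : ℤ)}).primesOver (NumberField.RingOfIntegers K)).ncard = 2) → Odd (NumberField.discr K) → NumberField.discr K ≠ -3 → κ₁.IsCyclotomic → κ₂.IsAnticyclotomic → p ∣ NumberField.classNumber K → (haveI : Fact (κ₂.IsTopGenerator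 γ₂) := ⟨Literature.NumberTheory.EllipticCurves.YanZhu2026.isTopGenerator_of_pair (κ₁ := κ₁) (γ₁ := γ₁)⟩; Module.IsTorsion (Literature.NumberTheory.EllipticCurves.IwasawaAlgebra p) (Literature.NumberTheory.EllipticCurves.Castella2018.AcSelmer.XAc (W.baseChange K) p κ₂ vbar ∅ γ₂)) → ∀ (ΩK : ℂ) (Ωp' : (Literature.NumberTheory.EllipticCurves.unrIntegers p)ˣ) (L : Literature.NumberTheory.EllipticCurves.UnrSeries p), ΩK ≠ 0 → Literature.NumberTheory.EllipticCurves.IsBDPLFunction ι v κ₂ γ₂ f ΩK ((Ωp' : Literature.NumberTheory.EllipticCurves.unrIntegers p) : PadicComplex p) L → ∀ J : ℤ_[p] →+* PadicComplexInt p, (∀ x : ℤ_[p], ((J x : PadicComplexInt p) : PadicComplex p) = ((x : ℚ_[p]) : PadicComplex p)) → ∀ (J₀ : Literature.NumberTheory.EllipticCurves.unrIntegers p →+* PadicComplexInt p), (∀ x : Literature.NumberTheory.EllipticCurves.unrIntegers p, ((J₀ x : PadicComplexInt p) : PadicComplex p) = (x : PadicComplex p)) → ∃ k : ℕ, ∀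 y ∈ (haveI : Fact (κ₂.IsTopGenerator γ₂) := ⟨Literature.NumberTheory.EllipticCurves.YanZhu2026.isTopGenerator_of_pair (κ₁ := κ₁) (γ₁ := γ₁)⟩; Literature.NumberTheory.EllipticCurves.Castella2018.AcSelmer.XAc.charIdeal (W.baseChange K) p κ₂ vbar ∅ γ₂).map (PowerSeries.map J), PowerSeries.C (((p : ℕ) : PadicComplexInt p) ^ k) * y ∈ Ideal.span {PowerSeries.map J₀ L} := by
  sorry

/-! ## Derived (v24): the v23 print stubs and S1 -/

/-- **(v37, DERIVED) Greenberg 2006 Prop. 4.1** from the Tate conjunct AT TOTALLY COMPLEX FIELDS of `stub_namedFactsSS` and the PROVED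
Harari Thm. 17.13 (a) at totally complex fields (`GaloisCohomology.forall_poitouTate_restricted_three_le_of_isTotallyComplex`, cell `bsd-eis`
p681302) by `Greenberg2006.prop41_of_tate_of_poitouTate_three_le_of_isTotallyComplex` (v31–v36: w8's `prop41_of_tateGlobalEulerPoincareCharacteristic`
from Tate + Poitou–Tate 17.13 (a) + NSW at EVERY number field). Display only: the composition consumes it inside `finiteExponentSS`. -/
theorem prop41SS : Literature.NumberTheory.IwasawaTheory.Greenberg2006.prop41_globalEulerPoincareCorank :=
  Literature.NumberTheory.IwasawaTheory.Greenberg2006.prop41_of_tate_of_poitouTate_three_le_of_isTotallyComplex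
    stub_namedFactsSS.2.2.2.2.1.2 Literature.NumberTheory.GaloisCohomology.forall_poitouTate_restricted_three_le_of_isTotallyComplex

/-- **(v37, DERIVED) the finite exponent of `X_Gr₂[T₁]` off the support** (the registered `stub_finiteExponentSS` text of v11–v23) from the TWO
Greenberg-road conjuncts left in `stub_namedFactsSS` — Greenberg 2016 Prop. 4.1.1 and Milne ADT I Thm. 5.1 at totally complex fields — by the lead
gen 14's `SignedBaseChangeAcDivOfFiniteExponentTateTC.finiteExponentSS_of_prop411_of_tateTC` (Greenberg 2016 Prop. 4.2.2, Greenberg 2006 §5 A /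
Prop. 4.2 tree theorems; Prop. 4.1 = `prop41SS`; Prop. 3.2 read from Tate (TC) in degrees `≤ 2` and unconditionally locally; v23–v36: the six-fold
`stub_greenberg2016FactsSS` with Prop. 3.2 in every degree at every number field ⟸ NSW (8.3.20) ⟸ Tate + Poitou–Tate 17.13 (a) everywhere). -/
theorem finiteExponentSS :
    SignedTwoVariableInputs → Literature.NumberTheory.EllipticCurves.ModularForms.nonempty_modularParametrizationData → ∀ (W : WeierstrassCurve ℚ) [W.IsElliptic] [W.IsGloballyMinimal] (p : ℕ) [Fact p.Prime], 5 ≤ p → W.HasGoodReductionAtPrime p → W.frobeniusTrace p = 0 → Literature.NumberTheory.EllipticCurves.Rank1Residual.Surj W p → ∀ (K : Type) [Field K] [NumberField K] (ι : PadicAlgCl p ≃+* ℂ) (v vbar : IsDedekindDomain.HeightOneSpectrum (NumberField.RingOfIntegers K)) (κ₁ κ₂ : Literature.NumberTheory.EllipticCurves.ZpExtension K p) (γ₁ γ₂ : Field.absoluteGaloisGroup K) [Fact (Literature.NumberTheory.EllipticCurves.ZpExtension.IsTopGeneratorPair κ₁ κ₂ γ₁ γ₂)] [NeZero (NumberField.discr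 K).natAbs] (N : ℕ) [NeZero N] (f : CuspForm (CongruenceSubgroup.Gamma0 N) 2), Literature.NumberTheory.EllipticCurves.ModularForms.IsNewformOf W f → (N : ℤ) = W.conductorNorm ℤ → Literature.NumberTheory.EllipticCurves.IsImaginaryQuadratic K → ((Ideal.span {(p : ℤ)}).primesOver (NumberField.RingOfIntegers K)).ncard = 2 → ((p : ℕ) : NumberField.RingOfIntegers K) ∈ v.asIdeal → ((p : ℕ) : NumberField.RingOfIntegers K) ∈ vbar.asIdeal → vbar ≠ v → (∀ (w : NumberField.InfinitePlace K) (k : NumberField.RingOfIntegers K), k ∈ v.asIdeal ↔ ‖ι.symm (w.embedding (k : K))‖ < 1) → IsCoprime (N : ℤ) (NumberField.discr K) → (∀ ℓ : ℕ, ℓ.Prime → ℓ ∣ N → ((Ideal.span {(ℓ : ℤ)}).primesOver (NumberField.RingOfIntegers K)).ncard = 2) → Odd (NumberField.discr K) → NumberField.discr K ≠ -3 → κ₁.IsCyclotomic → κ₂.IsAnticyclotomic → Literature.NumberTheory.EllipticCurves.Module.lengthAt (Literature.NumberTheory.EllipticCurves.IwasawaAlgebra₂ p) ((W.baseChange K).XGr₂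 p κ₁ κ₂ vbar γ₁ γ₂) ⟨Ideal.span {(PowerSeries.X : Literature.NumberTheory.EllipticCurves.IwasawaAlgebra₂ p)}, PowerSeries.span_X_isPrime⟩ = 0 → ∃ m : ℕ, ∀ x : (W.baseChange K).XGr₂ p κ₁ κ₂ vbar γ₁ γ₂, (PowerSeries.X : Literature.NumberTheory.EllipticCurves.IwasawaAlgebra₂ p) • x = 0 → ((p : Literature.NumberTheory.EllipticCurves.IwasawaAlgebra₂ p) ^ m) • x = 0 :=
  SignedBaseChangeAcDivOfFiniteExponentTateTC.finiteExponentSS_of_prop411_of_tateTC stub_namedFactsSS.2.2.2.2.1.1 stub_namedFactsSS.2.2.2.2.1.2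

/-- (v23 stub ORD, now DERIVED from `stub_namedFactsSS` by p550979.) -/
theorem stub_ordSlice :
    SignedTwoVariableInputs → Literature.NumberTheory.EllipticCurves.ModularForms.nonempty_modularParametrizationData → ∀ (W : WeierstrassCurve ℚ) [W.IsElliptic] [W.IsGloballyMinimal] (p : ℕ) [Fact p.Prime], 5 ≤ p → W.HasGoodReductionAtPrime p → Literature.NumberTheory.EllipticCurves.Rank1Residual.GoodOrd W p → Literature.NumberTheory.EllipticCurves.Rank1Residual.Surj W p → ∀ (K : Type) [Field K] [NumberField K] (ι : PadicAlgCl p ≃+* ℂ) (v vbar : IsDedekindDomain.HeightOneSpectrum (NumberField.RingOfIntegers K)) (κ₁ κ₂ : Literature.NumberTheory.EllipticCurves.ZpExtension K p) (γ₁ γ₂ : Field.absoluteGaloisGroup K) [Fact (Literature.NumberTheory.EllipticCurves.ZpExtension.IsTopGeneratorPair κ₁ κ₂ γ₁ γ₂)] [NeZero (NumberField.discr K).natAbs] (N : ℕ) [NeZero N] (f : CuspForm (CongruenceSubgroup.Gamma0 N) 2), Literature.NumberTheory.EllipticCurves.ModularForms.IsNewformOf W f → (N : ℤ) = W.conductorNorm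 ℤ → Literature.NumberTheory.EllipticCurves.IsImaginaryQuadratic K → ((Ideal.span {(p : ℤ)}).primesOver (NumberField.RingOfIntegers K)).ncard = 2 → ((p : ℕ) : NumberField.RingOfIntegers K) ∈ v.asIdeal → ((p : ℕ) : NumberField.RingOfIntegers K) ∈ vbar.asIdeal → vbar ≠ v → (∀ (w : NumberField.InfinitePlace K) (k : NumberField.RingOfIntegers K), k ∈ v.asIdeal ↔ ‖ι.symm (w.embedding (k : K))‖ < 1) → IsCoprime (N : ℤ) (NumberField.discr K) → (∀ ℓ : ℕ, ℓ.Prime → ℓ ∣ N → ((Ideal.span {(ℓ : ℤ)}).primesOver (NumberField.RingOfIntegers K)).ncard = 2) → Odd (NumberField.discr K) → NumberField.discr K ≠ -3 → κ₁.IsCyclotomic → κ₂.IsAnticyclotomic → ∀ (Ω δ : ℂ) (Ωp : (Literature.NumberTheory.EllipticCurves.unrIntegers p)ˣ) (LK G : PowerSeries (PowerSeries (PadicComplexInt p))), Ω ≠ 0 → (δ ^ 2 = (NumberField.discr K : ℂ) ∨ δ ^ 2 = -(NumberField.discr K : ℂ)) → Literature.NumberTheory.EllipticCurves.IsKatzMeasure₂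 ι v vbar ∅ κ₁ κ₂ γ₁⁻¹ γ₂⁻¹ 1 Ω δ ((Ωp : Literature.NumberTheory.EllipticCurves.unrIntegers p) : PadicComplex p) LK → Literature.NumberTheory.EllipticCurves.IsGreenbergLFunctionAnyRoot₂ ι v vbar κ₁ κ₂ γ₁⁻¹ γ₂⁻¹ f (NumberField.discr K).natAbs (NumberField.classNumber K) LK G → ∀ J : ℤ_[p] →+* PadicComplexInt p, (∀ x : ℤ_[p], ((J x : PadicComplexInt p) : PadicComplex p) = ((x : ℚ_[p]) : PadicComplex p)) → ((WeierstrassCurve.XGr₂.charIdeal (W.baseChange K) p κ₁ κ₂ vbar γ₁ γ₂).map (Literature.NumberTheory.EllipticCurves.IwasawaAlgebra₂.toUnr₂ p J)).map (PowerSeries.constantCoeff (R := PowerSeries (PadicComplexInt p))) ≤ Ideal.span {Literature.NumberTheory.EllipticCurves.UnrSeries₂.minus G} :=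
  SignedBaseChangeAcDivOrdinary.acDivChild_of_goodOrd stub_namedFactsSS.1.1 stub_namedFactsSS.1.2.1 stub_namedFactsSS.1.2.2

/-- (v23 stub (a1), now DERIVED from `stub_namedFactsSS` by p632902.) -/
theorem stub_xAcTorsionSS_coprime :
    SignedTwoVariableInputs → Literature.NumberTheory.EllipticCurves.ModularForms.nonempty_modularParametrizationData → ∀ (W : WeierstrassCurve ℚ) [W.IsElliptic] [W.IsGloballyMinimal] (p : ℕ) [Fact p.Prime], 5 ≤ p → W.HasGoodReductionAtPrime p → W.frobeniusTrace p = 0 → Literature.NumberTheory.EllipticCurves.Rank1Residual.Surj W p → ∀ (K : Type) [Field K] [NumberField K] (ι : PadicAlgCl p ≃+* ℂ) (v vbar : IsDedekindDomain.HeightOneSpectrum (NumberField.RingOfIntegers K)) (κ₁ κ₂ : Literature.NumberTheory.EllipticCurves.ZpExtension K p) (γ₁ γ₂ : Field.absoluteGaloisGroup K) [Fact (Literature.NumberTheory.EllipticCurves.ZpExtension.IsTopGeneratorPair κ₁ κ₂ γ₁ γ₂)] [NeZero (NumberField.discr K).natAbs] (N : ℕ) [NeZero N] (f : CuspForm (CongruenceSubgroup.Gamma0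 N) 2), Literature.NumberTheory.EllipticCurves.ModularForms.IsNewformOf W f → (N : ℤ) = W.conductorNorm ℤ → Literature.NumberTheory.EllipticCurves.IsImaginaryQuadratic K → ((Ideal.span {(p : ℤ)}).primesOver (NumberField.RingOfIntegers K)).ncard = 2 → ((p : ℕ) : NumberField.RingOfIntegers K) ∈ v.asIdeal → ((p : ℕ) : NumberField.RingOfIntegers K) ∈ vbar.asIdeal → vbar ≠ v → (∀ (w : NumberField.InfinitePlace K) (k : NumberField.RingOfIntegers K), k ∈ v.asIdeal ↔ ‖ι.symm (w.embedding (k : K))‖ < 1) → IsCoprime (N : ℤ) (NumberField.discr K) → (∀ ℓ : ℕ, ℓ.Prime → ℓ ∣ N → ((Ideal.span {(ℓ : ℤ)}).primesOver (NumberField.RingOfIntegers K)).ncard = 2) → Odd (NumberField.discr K) → NumberField.discr K ≠ -3 → κ₁.IsCyclotomic → κ₂.IsAnticyclotomic → ¬ p ∣ NumberField.classNumber K → (haveI : Fact (κ₂.IsTopGenerator γ₂) := ⟨Literature.NumberTheory.EllipticCurves.YanZhu2026.isTopGenerator_of_pair (κ₁ := κ₁) (γ₁ := γ₁)⟩; Module.IsTorsion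 (Literature.NumberTheory.EllipticCurves.IwasawaAlgebra p) (Literature.NumberTheory.EllipticCurves.Castella2018.AcSelmer.XAc (W.baseChange K) p κ₂ vbar ∅ γ₂)) :=
  SignedBaseChangeAcDivXAcTorsionOfLongoVigni.xAcTorsionSS_of_longoVigni_castellaWan stub_namedFactsSS.2.1 stub_namedFactsSS.2.2.1

/-- (v23 stub S3, now DERIVED from `stub_namedFactsSS` — v34: by the BCS copy `stub_minusIsBDP_ss_of_bcs` (p670235) of p630219.) -/
theorem stub_minusIsBDP :
    SignedTwoVariableInputs → Literature.NumberTheory.EllipticCurves.ModularForms.nonempty_modularParametrizationData → ∀ (W : WeierstrassCurve ℚ) [W.IsElliptic] [W.IsGloballyMinimal] (p : ℕ) [Fact p.Prime], 5 ≤ p → W.HasGoodReductionAtPrime p → W.frobeniusTrace p = 0 → Literature.NumberTheory.EllipticCurves.Rank1Residual.Surj W p → ∀ (K : Type) [Field K] [NumberField K] (ι : PadicAlgCl p ≃+* ℂ) (v vbar : IsDedekindDomain.HeightOneSpectrum (NumberField.RingOfIntegers K)) (κ₁ κ₂ : Literature.NumberTheory.EllipticCurves.ZpExtension K p) (γ₁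 γ₂ : Field.absoluteGaloisGroup K) [Fact (Literature.NumberTheory.EllipticCurves.ZpExtension.IsTopGeneratorPair κ₁ κ₂ γ₁ γ₂)] [NeZero (NumberField.discr K).natAbs] (N : ℕ) [NeZero N] (f : CuspForm (CongruenceSubgroup.Gamma0 N) 2), Literature.NumberTheory.EllipticCurves.ModularForms.IsNewformOf W f → (N : ℤ) = W.conductorNorm ℤ → Literature.NumberTheory.EllipticCurves.IsImaginaryQuadratic K → ((Ideal.span {(p : ℤ)}).primesOver (NumberField.RingOfIntegers K)).ncard = 2 → ((p : ℕ) : NumberField.RingOfIntegers K) ∈ v.asIdeal → ((p : ℕ) : NumberField.RingOfIntegers K) ∈ vbar.asIdeal → vbar ≠ v → (∀ (w : NumberField.InfinitePlace K) (k : NumberField.RingOfIntegers K), k ∈ v.asIdeal ↔ ‖ι.symm (w.embedding (k : K))‖ < 1) → IsCoprime (N : ℤ) (NumberField.discr K) → (∀ ℓ : ℕ, ℓ.Prime → ℓ ∣ N → ((Ideal.span {(ℓ : ℤ)}).primesOver (NumberField.RingOfIntegers K)).ncard = 2) → Odd (NumberField.discr K) → NumberField.discr K ≠ -3 → κ₁.IsCyclotomic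 → κ₂.IsAnticyclotomic → ∀ (Ω δ : ℂ) (Ωp : (Literature.NumberTheory.EllipticCurves.unrIntegers p)ˣ) (LK G : PowerSeries (PowerSeries (PadicComplexInt p))), Ω ≠ 0 → (δ ^ 2 = (NumberField.discr K : ℂ) ∨ δ ^ 2 = -(NumberField.discr K : ℂ)) → Literature.NumberTheory.EllipticCurves.IsKatzMeasure₂ ι v vbar ∅ κ₁ κ₂ γ₁⁻¹ γ₂⁻¹ 1 Ω δ ((Ωp : Literature.NumberTheory.EllipticCurves.unrIntegers p) : PadicComplex p) LK → Literature.NumberTheory.EllipticCurves.IsGreenbergLFunctionAnyRoot₂ ι v vbar κ₁ κ₂ γ₁⁻¹ γ₂⁻¹ f (NumberField.discr K).natAbs (NumberField.classNumber K) LK G → ∃ (ΩK : ℂ) (Ωp' : (Literature.NumberTheory.EllipticCurves.unrIntegers p)ˣ) (L : Literature.NumberTheory.EllipticCurves.UnrSeries p), ΩK ≠ 0 ∧ Literature.NumberTheory.EllipticCurves.IsBDPLFunction ι v κ₂ γ₂ f ΩK ((Ωp' : Literature.NumberTheory.EllipticCurves.unrIntegers p) : PadicComplex p) L ∧ ∀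 (J₀ : Literature.NumberTheory.EllipticCurves.unrIntegers p →+* PadicComplexInt p), (∀ x : Literature.NumberTheory.EllipticCurves.unrIntegers p, ((J₀ x : PadicComplexInt p) : PadicComplex p) = (x : PadicComplex p)) → Ideal.span {Literature.NumberTheory.EllipticCurves.UnrSeries₂.minus G} = Ideal.span {PowerSeries.map J₀ L} :=
  SignedBaseChangeAcDivMinusIsBDPSSBCS.stub_minusIsBDP_ss_of_bcs stub_namedFactsSS.2.2.2.2.2.1 stub_namedFactsSS.2.2.2.2.2.2.1

/-- **S1 (registered text of v11–v23, now DERIVED; v24)**: `p ∣ h_K` ⟶ `stub_bdpLowerHalfRatSS_classDvd`; `p ∤ h_K` ∧ every prime of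
`N` to the second power ⟶ the BLV conjunct of `stub_namedFactsSS` through
`SignedBaseChangeAcDivBdpLowerHalfAllAdditive.bdpLowerHalfRatSS_allAdditive_of_BLV`; `p ∤ h_K` otherwise ⟶
(v36) the research stub `stub_bdpLowerHalfRatSS_mult` DIRECTLY (v33–v35: Form T `stub_signedEisensteinSS_mult` + four conjuncts through
`SignedBaseChangeAcDivS1OfSignedEisensteinMult.bdpLowerHalfRatSS_mult_of_signedEisensteinMult`); v29: BEFORE the
Form-T branch, `p ∤ h_K` ∧ `Squarefree N` ∧ `E[p]` ramified at every `q ∣ N` ⟶ the CHKLL conjunct of `stub_namedFactsSS` through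
`SignedBaseChangeAcDivBdpLowerHalfSemistable.bdpLowerHalfRatSS_semistable_of_CHKLL` (PRINT, refereed 2025). -/
theorem stub_bdpLowerHalfRatSS :
    SignedTwoVariableInputs → Literature.NumberTheory.EllipticCurves.ModularForms.nonempty_modularParametrizationData → ∀ (W : WeierstrassCurve ℚ) [W.IsElliptic] [W.IsGloballyMinimal] (p : ℕ) [Fact p.Prime], 5 ≤ p → W.HasGoodReductionAtPrime p → W.frobeniusTrace p = 0 → Literature.NumberTheory.EllipticCurves.Rank1Residual.Surj W p → ∀ (K : Type) [Field K] [NumberField K] (ι : PadicAlgCl p ≃+* ℂ) (v vbar : IsDedekindDomain.HeightOneSpectrum (NumberField.RingOfIntegers K)) (κ₁ κ₂ : Literature.NumberTheory.EllipticCurves.ZpExtension K p) (γ₁ γ₂ : Field.absoluteGaloisGroup K) [Fact (Literature.NumberTheory.EllipticCurves.ZpExtension.IsTopGeneratorPair κ₁ κ₂ γ₁ γ₂)] [NeZero (NumberField.discr K).natAbs] (N : ℕ) [NeZero N] (f : CuspForm (CongruenceSubgroup.Gamma0 N) 2), Literature.NumberTheory.EllipticCurves.ModularForms.IsNewformOf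 W f → (N : ℤ) = W.conductorNorm ℤ → Literature.NumberTheory.EllipticCurves.IsImaginaryQuadratic K → ((Ideal.span {(p : ℤ)}).primesOver (NumberField.RingOfIntegers K)).ncard = 2 → ((p : ℕ) : NumberField.RingOfIntegers K) ∈ v.asIdeal → ((p : ℕ) : NumberField.RingOfIntegers K) ∈ vbar.asIdeal → vbar ≠ v → (∀ (w : NumberField.InfinitePlace K) (k : NumberField.RingOfIntegers K), k ∈ v.asIdeal ↔ ‖ι.symm (w.embedding (k : K))‖ < 1) → IsCoprime (N : ℤ) (NumberField.discr K) → (∀ ℓ : ℕ, ℓ.Prime → ℓ ∣ N → ((Ideal.span {(ℓ : ℤ)}).primesOver (NumberField.RingOfIntegers K)).ncard = 2) → Odd (NumberField.discr K) → NumberField.discr K ≠ -3 → κ₁.IsCyclotomic → κ₂.IsAnticyclotomic → (haveI : Fact (κ₂.IsTopGenerator γ₂) := ⟨Literature.NumberTheory.EllipticCurves.YanZhu2026.isTopGenerator_of_pair (κ₁ := κ₁) (γ₁ := γ₁)⟩; Module.IsTorsion (Literature.NumberTheory.EllipticCurves.IwasawaAlgebra p) (Literature.NumberTheory.EllipticCurves.Castella2018.AcSelmer.XAc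 (W.baseChange K) p κ₂ vbar ∅ γ₂)) → ∀ (ΩK : ℂ) (Ωp' : (Literature.NumberTheory.EllipticCurves.unrIntegers p)ˣ) (L : Literature.NumberTheory.EllipticCurves.UnrSeries p), ΩK ≠ 0 → Literature.NumberTheory.EllipticCurves.IsBDPLFunction ι v κ₂ γ₂ f ΩK ((Ωp' : Literature.NumberTheory.EllipticCurves.unrIntegers p) : PadicComplex p) L → ∀ J : ℤ_[p] →+* PadicComplexInt p, (∀ x : ℤ_[p], ((J x : PadicComplexInt p) : PadicComplex p) = ((x : ℚ_[p]) : PadicComplex p)) → ∀ (J₀ : Literature.NumberTheory.EllipticCurves.unrIntegers p →+* PadicComplexInt p), (∀ x : Literature.NumberTheory.EllipticCurves.unrIntegers p, ((J₀ x : PadicComplexInt p) : PadicComplex p) = (x : PadicComplex p)) → ∃ k : ℕ, ∀ y ∈ (haveI : Fact (κ₂.IsTopGenerator γ₂) := ⟨Literature.NumberTheory.EllipticCurves.YanZhu2026.isTopGenerator_of_pair (κ₁ := κ₁) (γ₁ := γ₁)⟩; Literature.NumberTheory.EllipticCurves.Castella2018.AcSelmer.XAc.charIdeal (W.baseChange K)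 p κ₂ vbar ∅ γ₂).map (PowerSeries.map J), PowerSeries.C (((p : ℕ) : PadicComplexInt p) ^ k) * y ∈ Ideal.span {PowerSeries.map J₀ L} := by
  intro hIn hmodP W _ _ p _ hp hgood ha0 hs K _ _ ι v vbar κ₁ κ₂ γ₁ γ₂ _ _ N _ f hf hN hK hsplit hv hvbar hvv hι hcop hHeeg hodd
    hne3 hκ₁ hκ₂
  by_cases hh : p ∣ NumberField.classNumber K
  · exact stub_bdpLowerHalfRatSS_classDvd hIn hmodP W p hp hgood ha0 hs K ι v vbar κ₁ κ₂ γ₁ γ₂ N f hf hN hK hsplit hv hvbar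
      hvv hι hcop hHeeg hodd hne3 hκ₁ hκ₂ hh
  · by_cases hsq : ∀ ℓ : ℕ, ℓ.Prime → ℓ ∣ N → ℓ ^ 2 ∣ N
    · exact SignedBaseChangeAcDivBdpLowerHalfAllAdditive.bdpLowerHalfRatSS_allAdditive_of_BLV stub_namedFactsSS.2.2.2.1 hIn
        hmodP W p hp hgood ha0 hs K ι v vbar κ₁ κ₂ γ₁ γ₂ N f hf hN hK hsplit hv hvbar hvv hι hcop hHeeg hodd hne3 hκ₁ hκ₂ hh hsq
    · by_cases hss : Squarefree N ∧ ∀ q : ℕ, q.Prime → q ∣ N →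
          ∃ v' : IsDedekindDomain.HeightOneSpectrum (NumberField.RingOfIntegers ℚ),
            ((q : ℕ) : NumberField.RingOfIntegers ℚ) ∈ v'.asIdeal ∧ ∃ 𝔓 ∈ v'.primesAbove,
              ∃ σ ∈ 𝔓.inertia (Field.absoluteGaloisGroup ℚ), ∃ P : W.geomTorsion (p : ℤ), σ • P ≠ P
      · -- v29: the SEMISTABLE slice (square-free `N`, `E[p]` ramified at every `q ∣ N`) is PRINT: CHKLL 2025 Thm 7.1 / Cor 7.2
        exact SignedBaseChangeAcDivBdpLowerHalfSemistable.bdpLowerHalfRatSS_semistable_of_CHKLL stub_namedFactsSS.2.2.2.2.2.2.2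
          hIn hmodP W p hp hgood ha0 hs K ι v vbar κ₁ κ₂ γ₁ γ₂ N f hf hN hK hsplit hv hvbar hvv hι hcop hHeeg hodd hne3 hκ₁ hκ₂ hh
          hss.1 hss.2
      · -- v36: cells β/γ are the RESEARCH stub, stated directly in BDP currency (the branch's own `hh`, `hss`, `hsq` are passed)
        exact stub_bdpLowerHalfRatSS_mult hIn hmodP W p hp hgood ha0 hs K ι v vbar κ₁ κ₂ γ₁ γ₂ N f hf hN hK hh hss hsq hsplit hv
          hvbar hvv hι hcop hHeeg hodd hne3 hκ₁ hκ₂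

/-! ## The composition (v24): gen 3's kernel census of the refereed road, fed by the stubs -/

/-- **The crux BY NAME from the four stubs** (v37: the lead gen 14's `SignedBaseChangeAcDivOfFiniteExponentTateTC.anticyclotomicEisensteinDivisibility_of_xAcTorsionSS_of_finiteExponent`,
the pointwise copy of the BCS census p670235∘p633742 with the Greenberg road entering through the derived `finiteExponentSS`: ordinary slice from YZ26;
supersingular slice via `Module.Finite Λ₂ X_Gr₂`, torsion from (a) = (a1) refereed ∨ (a2), finite exponent from Greenberg 2016 Prop. 4.1.1 + Tate (TC) +
the proved kernel bricks, rational specialisation `T₁ ↦ 0`, S1, S3, frame rigidity, `μ(G⁻) = 0`). -/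
theorem AnticyclotomicEisensteinDivisibility_of :
    Summit.BirchSwinnertonDyer.BirchSwinnertonDyer.Theses.SignedBaseChange.AnticyclotomicEisensteinDivisibility :=
  SignedBaseChangeAcDivOfFiniteExponentTateTC.anticyclotomicEisensteinDivisibility_of_xAcTorsionSS_of_finiteExponent stub_namedFactsSS.1.1
    stub_namedFactsSS.1.2.1 stub_namedFactsSS.1.2.2
    (SignedBaseChangeAcDivOfFactsRefereed.xAcTorsionSS_of_refereed_of_classDvd stub_namedFactsSS.2.1 stub_namedFactsSS.2.2.1
      stub_xAcTorsionSS_classDvd)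
    finiteExponentSS stub_namedFactsSS.2.2.2.2.2.1 stub_namedFactsSS.2.2.2.2.2.2.1 stub_bdpLowerHalfRatSS

end Summit.BirchSwinnertonDyer.BirchSwinnertonDyer.Cruxes.AnticyclotomicEisensteinDivisibility.Bdpline

end
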